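import Mathlib
import HarnessLib
import Summits.HubbardSuperconductivity.HubbardSuperconductivity.Theorems.KLProgrammeKLRegimeEngineScaleZeroE4Defs
import Summits.HubbardSuperconductivity.HubbardSuperconductivity.Theorems.KLProgrammeKLRegimeSplitPredicates

/-!
# K3 engine child (`KLRegimeEngineV14`, stmt-HubbardSuperconductivity-19918), stub `stub_engine_scale0`, clause (E4)₀:
# the position data of the decay-weighted scale-`0` step are a tree weight, and the route's `spaceTimeDist` is dominated by it

Cell gate-hubbard-kl, seat hubbard-kl-k3c2-p1.  Companion of `…ScaleZeroE4Defs` (`gridLabelDist`, `gridLabelWt`, `gridLegPos`, `latticeLegPos`):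

* `isLabelDist_gridLabelDist`, `isTreeWeight_gridLabelWt`, `gridLabelWt_pair` (`wt{a,b} = 1 + d(a,b)`), `gridLabelDist_le_gridLabelWt_image`
  (the distance of two positions of a tuple is at most the weight of the tuple's position set);
* the arithmetic of the circular distances: `circDist_eq_min_val` (the route's `circDist N a b` on `ℕ` is `min((a-b) mod N, (b-a) mod N)` read in
  `ZMod N`), `cyclicDist_eq_min_val`, `circDist_eq_cyclicDist`, `circDist_two_mul` (`circDist (2N) (2a) (2b) = 2·circDist N a b`),
  `torusSiteDist_eq_max_circDist` (the periodic `ℓ^∞` distance of `(ℤ/L)²` is the larger of the two coordinate circular distances);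
* **`spaceTimeDist_le_gridLabelDist`** — for `x, y : SpaceTimeIdx L M`,
  `spaceTimeDist L M β x y ≤ gridLabelDist L (4M) β (2x₀ mod 4M, x⃗) (2y₀ mod 4M, y⃗)` (`max ≤ sum`; the time parts agree:
  `(β/2M)·circDist (2M) = (β/4M)·circDist (4M)` on doubled indices), and `spaceTimeDist_le_gridLabelDist_latticeLegPos` (the same through
  `latticeLegPos (4M)`).

Everything is proved; no definitions, no named facts, no sorry.
-/

noncomputable section

namespace Summit.HubbardSuperconductivity.HubbardSuperconductivity.Theorems.EngineV8

set_option linter.dupNamespace false -- summit = problem name (single-conjunct summit), D-0017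

open Real Finset Literature.MathematicalPhysics.QuantumLattice Literature.Probability.LatticeModels
open Literature.Probability.LatticeModels.BattleFederbush
open Summit.HubbardSuperconductivity.HubbardSuperconductivity.Theorems.KLRegimeSplit

/-! ## §1 The label pseudo-distance and the tree weight -/

/-- `gridLabelDist L Ng β` is a label pseudo-distance (`β ≥ 0`, `Ng, L ≠ 0`). -/
theorem isLabelDist_gridLabelDist (L Ng : ℕ) [NeZero L] [NeZero Ng] {β : ℝ} (hβ : 0 ≤ β) :
    IsLabelDist (gridLabelDist L Ng β) := by
  have hct : 0 ≤ β / Ng := div_nonneg hβ (Nat.cast_nonneg _)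
  have h := (((isLabelDist_cyclicDist Ng).comap (Prod.fst : ZMod Ng × TorusSite 2 L → ZMod Ng)).smul hct).add
    (isLabelDist_torusSiteDist.comap (Prod.snd : ZMod Ng × TorusSite 2 L → TorusSite 2 L))
  exact h

/-- The distance is nonnegative (`β ≥ 0`). -/
theorem gridLabelDist_nonneg (L Ng : ℕ) {β : ℝ} (hβ : 0 ≤ β) (a b : ZMod Ng × TorusSite 2 L) : 0 ≤ gridLabelDist L Ng β a b := by
  rw [gridLabelDist_apply]
  exact add_nonneg (mul_nonneg (div_nonneg hβ (Nat.cast_nonneg _)) (Nat.cast_nonneg _)) (Nat.cast_nonneg _)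

/-- `gridLabelWt` is the diameter weight `S ↦ 1 + diam S`. -/
theorem gridLabelWt_eq_diamWeight (L Ng : ℕ) (β : ℝ) :
    gridLabelWt L Ng β = diamWeight (fun s => 1 + s) (gridLabelDist L Ng β) := by
  funext S
  rfl

/-- **`gridLabelWt L Ng β` is a tree weight** (`β ≥ 0`): `1 ≤ wt`, monotone, submultiplicative on overlapping unions
(`1 + (s + t) ≤ (1 + s)(1 + t)`). -/
theorem isTreeWeight_gridLabelWt (L Ng : ℕ) [NeZero L] [NeZero Ng] {β : ℝ} (hβ : 0 ≤ β) : IsTreeWeight (gridLabelWt L Ng β) := by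
  rw [gridLabelWt_eq_diamWeight]
  refine isTreeWeight_diamWeight (isLabelDist_gridLabelDist L Ng hβ) (fun s hs => by linarith) (fun s t _ hst => by linarith)
    (fun s t hs ht => by nlinarith)

/-- `1 ≤ gridLabelWt`. -/
theorem one_le_gridLabelWt (L Ng : ℕ) (β : ℝ) (S : Finset (ZMod Ng × TorusSite 2 L)) : 1 ≤ gridLabelWt L Ng β S := by
  rw [gridLabelWt_apply]
  exact le_add_of_nonneg_right (labelDiam_nonneg _ _)

/-- **The pair weight**: `wt{a, b} = 1 + d(a, b)`. -/
theorem gridLabelWt_pair (L Ng : ℕ) [NeZero L] [NeZero Ng] {β : ℝ} (hβ : 0 ≤ β) (a b : ZMod Ng × TorusSite 2 L) :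
    gridLabelWt L Ng β {a, b} = 1 + gridLabelDist L Ng β a b := by
  rw [gridLabelWt_apply, labelDiam_pair (isLabelDist_gridLabelDist L Ng hβ)]

/-- **Distances inside a tuple are dominated by the weight of its position set**: `d(P i, P k) ≤ wt(image P) - 1`. -/
theorem gridLabelDist_le_gridLabelWt_image_sub_one {ι : Type*} [Fintype ι] [DecidableEq ι] (L Ng : ℕ) (β : ℝ)
    (P : ι → ZMod Ng × TorusSite 2 L) (i k : ι) :
    gridLabelDist L Ng β (P i) (P k) ≤ gridLabelWt L Ng β (univ.image P) - 1 := by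
  rw [gridLabelWt_apply, add_sub_cancel_left]
  exact le_labelDiam _ (mem_image_of_mem _ (mem_univ i)) (mem_image_of_mem _ (mem_univ k))

/-- `d(P i, P k) ≤ wt(image P)`. -/
theorem gridLabelDist_le_gridLabelWt_image {ι : Type*} [Fintype ι] [DecidableEq ι] (L Ng : ℕ) (β : ℝ)
    (P : ι → ZMod Ng × TorusSite 2 L) (i k : ι) :
    gridLabelDist L Ng β (P i) (P k) ≤ gridLabelWt L Ng β (univ.image P) :=
  (gridLabelDist_le_gridLabelWt_image_sub_one L Ng β P i k).trans (by linarith [one_le_gridLabelWt L Ng β (univ.image P)])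

/-! ## §2 Circular distances: the route's `circDist` on `ℕ`, `cyclicDist` on `ZMod`, doubling, and the torus `ℓ^∞` distance -/

/-- `(a + N - b % N) % N = val ((a : ZMod N) - b)`. -/
theorem add_sub_mod_mod_eq_val_sub (N a b : ℕ) [NeZero N] : (a + N - b % N) % N = (((a : ZMod N) - (b : ZMod N)).val) := by
  have hb : b % N < N := Nat.mod_lt _ (Nat.pos_of_ne_zero (NeZero.ne N))
  have hcast : (((a + N - b % N : ℕ) : ZMod N)) = (a : ZMod N) - (b : ZMod N) := by
    have h : ((a + N - b % N : ℕ) : ZMod N) + ((b % N : ℕ) : ZMod N) = (a : ZMod N) := by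
      rw [← Nat.cast_add, Nat.sub_add_cancel (by omega), Nat.cast_add, ZMod.natCast_self, add_zero]
    rw [ZMod.natCast_mod] at h
    exact eq_sub_of_add_eq h
  rw [← hcast, ZMod.val_natCast]

/-- **The route's circular distance in `ZMod` form**: `circDist N a b = min (val (a - b)) (val (b - a))` (casts into `ZMod N`). -/
theorem circDist_eq_min_val (N a b : ℕ) [NeZero N] :
    circDist N a b = min (((a : ZMod N) - (b : ZMod N)).val) (((b : ZMod N) - (a : ZMod N)).val) := by
  rw [circDist, add_sub_mod_mod_eq_val_sub, add_sub_mod_mod_eq_val_sub]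

/-- `cyclicDist N x y = min (val (x - y)) (val (y - x))` (the two expressions of the cyclic absolute value agree). -/
theorem cyclicDist_eq_min_val (N : ℕ) [NeZero N] (x y : ZMod N) :
    cyclicDist N x y = ((min (x - y).val (y - x).val : ℕ) : ℝ) := by
  rw [cyclicDist]
  congr 1
  by_cases h : x - y = 0
  · have h' : y - x = 0 := by rw [← neg_sub, h, neg_zero]
    rw [h, h', ZMod.val_zero]
    simp
  · haveI : NeZero (x - y) := ⟨h⟩
    rw [show y - x = -(x - y) by ring, ZMod.val_neg_of_ne_zero]

/-- **`circDist = cyclicDist`** on the casts. -/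
theorem circDist_eq_cyclicDist (N a b : ℕ) [NeZero N] : (circDist N a b : ℝ) = cyclicDist N (a : ZMod N) (b : ZMod N) := by
  rw [cyclicDist_eq_min_val, circDist_eq_min_val]

/-- **Doubling**: `circDist (2N) (2a) (2b) = 2·circDist N a b`. -/
theorem circDist_two_mul (N a b : ℕ) (hN : 0 < N) : circDist (2 * N) (2 * a) (2 * b) = 2 * circDist N a b := by
  have h1 : ∀ a b : ℕ, (2 * a + 2 * N - 2 * b % (2 * N)) % (2 * N) = 2 * ((a + N - b % N) % N) := by
    intro a b
    have hb : b % N ≤ N := (Nat.mod_lt _ hN).le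
    rw [Nat.mul_mod_mul_left 2 b N, show 2 * a + 2 * N - 2 * (b % N) = 2 * (a + N - b % N) by omega, Nat.mul_mod_mul_left]
  rw [circDist, circDist, h1, h1, Nat.mul_min_mul_left]

/-- The coordinate circular distance of two torus sites is the cyclic absolute value of their difference. -/
theorem circDist_val_eq (L : ℕ) [NeZero L] (u v : ZMod L) :
    circDist L u.val v.val = min (u - v).val (v - u).val := by
  rw [circDist_eq_min_val, ZMod.natCast_zmod_val, ZMod.natCast_zmod_val]

/-- **The periodic `ℓ^∞` distance of `(ℤ/L)²` is the larger coordinate circular distance**: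
`torusSiteDist x y = max (circDist L (x 0) (y 0)) (circDist L (x 1) (y 1))` (on `val`s). -/
theorem torusSiteDist_eq_max_circDist (L : ℕ) [NeZero L] (x y : TorusSite 2 L) :
    torusSiteDist x y = max (circDist L (x 0).val (y 0).val : ℝ) (circDist L (x 1).val (y 1).val : ℝ) := by
  rw [torusSiteDist, torusDist, torusNorm, circDist_val_eq, circDist_val_eq]
  have hcyc : ∀ i : Fin 2, min ((x - y) i).val (L - ((x - y) i).val) = min (x i - y i).val (y i - x i).val := by
    intro i
    rw [Pi.sub_apply]
    by_cases h : x i - y i = 0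
    · have h' : y i - x i = 0 := by rw [← neg_sub, h, neg_zero]
      rw [h, h', ZMod.val_zero]
      simp
    · haveI : NeZero (x i - y i) := ⟨h⟩
      rw [show y i - x i = -(x i - y i) by ring, ZMod.val_neg_of_ne_zero]
  rw [show (univ : Finset (Fin 2)) = {0, 1} from by ext i; fin_cases i <;> simp, sup_insert, sup_singleton, hcyc, hcyc]
  push_cast
  rfl

/-! ## §3 The route's `spaceTimeDist` is dominated by `gridLabelDist` of the doubled positions -/

/-- **`spaceTimeDist ≤ gridLabelDist ∘ (doubling)`**: for `x, y : SpaceTimeIdx L M`,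
`spaceTimeDist L M β x y ≤ gridLabelDist L (2(2M)) β (2x₀ mod 4M, x⃗) (2y₀ mod 4M, y⃗)` (`β ≥ 0`; the time parts coincide, the space part of
the left side is the `ℓ^∞` distance, and `max ≤ +`). -/
theorem spaceTimeDist_le_gridLabelDist {L M : ℕ} [NeZero L] [NeZero M] {β : ℝ} (hβ : 0 ≤ β) (x y : SpaceTimeIdx L M) :
    KLRegimeSplit.spaceTimeDist L M β x y ≤
      gridLabelDist L (2 * (2 * M)) β ((((2 * (x.1 : ℕ) : ℕ) : ZMod (2 * (2 * M)))), x.2) ((((2 * (y.1 : ℕ) : ℕ) : ZMod (2 * (2 * M)))), y.2) := by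
  haveI : NeZero (2 * (2 * M)) := ⟨by have := NeZero.ne M; omega⟩
  have hM : (0 : ℝ) < M := by exact_mod_cast Nat.pos_of_ne_zero (NeZero.ne M)
  -- the time parts agree
  have htime : imagTimeWeight β M * (circDist (2 * M) x.1.val y.1.val : ℝ) =
      β / (2 * (2 * M) : ℕ) * cyclicDist (2 * (2 * M)) (((2 * (x.1 : ℕ) : ℕ) : ZMod (2 * (2 * M)))) (((2 * (y.1 : ℕ) : ℕ) : ZMod (2 * (2 * M)))) := by
    rw [← circDist_eq_cyclicDist, circDist_two_mul _ _ _ (by have := NeZero.ne M; omega), imagTimeWeight]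
    push_cast
    field_simp
  -- the space part is the torus distance
  have hspace : max (circDist L (x.2 0).val (y.2 0).val : ℝ) (circDist L (x.2 1).val (y.2 1).val : ℝ) = torusSiteDist x.2 y.2 :=
    (torusSiteDist_eq_max_circDist L x.2 y.2).symm
  have hT0 : 0 ≤ β / (2 * (2 * M) : ℕ) * cyclicDist (2 * (2 * M)) (((2 * (x.1 : ℕ) : ℕ) : ZMod (2 * (2 * M)))) (((2 * (y.1 : ℕ) : ℕ) : ZMod (2 * (2 * M)))) :=
    mul_nonneg (div_nonneg hβ (Nat.cast_nonneg _)) (Nat.cast_nonneg _)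
  have hS0 : 0 ≤ torusSiteDist x.2 y.2 := Nat.cast_nonneg _
  rw [KLRegimeSplit.spaceTimeDist, gridLabelDist_apply, htime, hspace]
  exact max_le (le_add_of_nonneg_right hS0) (le_add_of_nonneg_left hT0)

/-- The same through `latticeLegPos (4M)` (the sector label is invisible). -/
theorem spaceTimeDist_le_gridLabelDist_latticeLegPos {L M Ns : ℕ} [NeZero L] [NeZero M] {β : ℝ} (hβ : 0 ≤ β)
    (X Y : SpaceTimeIdx L M × SectorLeg Ns) :
    KLRegimeSplit.spaceTimeDist L M β X.1 Y.1 ≤ gridLabelDist L (2 * (2 * M)) β (latticeLegPos (2 * (2 * M)) X) (latticeLegPos (2 * (2 * M)) Y) := by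
  rw [latticeLegPos_apply, latticeLegPos_apply]
  exact spaceTimeDist_le_gridLabelDist hβ X.1 Y.1

end Summit.HubbardSuperconductivity.HubbardSuperconductivity.Theorems.EngineV8

end
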